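import Summits.NavierStokesRegularity.FluidComputer.PalasekTowerStrainDoorAtSharp
import Literature.Analysis.FluidPDE.ForcedOseenPointwiseEnergyBound
import Literature.Analysis.FluidPDE.LerayEnstrophyAPrioriForced

/-!
# THE STRAIN DOOR AT ARBITRARY RATES `R`, III: the RAW strain certificate — explicit fields, the RAW
# residual as the force, numerals — re-gauged inside the kernel to the letter of the numeral door

Cell `ns-blowup`, seat `ns-palasek-20303-p1` (LEAD prover on stmt-NavierStokesRegularity-20303 `EpisodeBaseT`;
route `PalasekTowerBreakdown`, rev 19; line `straindoor` at `tuned`). Sequel of `PalasekTowerStrainDoorAt.lean`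
(p528856) and `PalasekTowerStrainDoorAtSharp.lean`. LABEL: E–C typing + kernel analysis (one open `Prop`
parametrised by the rates record — the RAW certificate letter — and its sorry-free reduction to the numeral
letter). WHAT THIS IS NOT: not Navier–Stokes evidence — nothing is inhabited; no run, design or certificate
is exhibited; the raw certificate is OPEN at `R = tuned`.

## Why

The numeral letter `StrainDoor.CertificateDataSharp R` (= the hypotheses of the numeral strain-shadowed-run
door `StrainShadowSharp.exists_freeRun_near_of_strain`, fc-prover-3 g10 p529071) still asks the certificate
for three things a COMPUTATION cannot supply as such: (i) a reference run forced by a WEAKLY DIVERGENCE-FREE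
defect `g` (the true residual `r = ∂ₜw + (w·∇)w + ∇ψ − Δw` of an explicit pair `(w, ψ)` is never divergence
free unless `ψ` is the exact Navier–Stokes pressure of `w`, a non-explicit Newtonian potential), (ii) Tao's
`L²`-Sobolev class for `w`, `∂ₜw` and the pressure, (iii) an `L²` bound of the PROJECTED defect. This file
removes all three INSIDE THE KERNEL:

* `RawCertificateData R U ρ w ψ r Γ B_w G₂ D E₀ h δ η` — **THE RAW LETTER**: an explicit datum `U` (smooth,
  divergence free, `tsupport U ⊆ B̄(0,ρ)`, speed `< Y₀(R)`), an explicit pair `(w, ψ)` which is a classical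
  solution on `[0, wfirstAt R]` of the system FORCED BY ITS OWN RAW RESIDUAL `r` (i.e. `r` is DEFINED by the
  momentum equation — `isClassicalNSSolutionOn_of_residual` below makes this a tautology for any jointly
  smooth divergence-free `w` and jointly smooth `ψ`), uniform Schwartz bounds on the slab for `w`, `ψ`, `r`
  (`HasUniformRapidDecayOn`; automatic for fields supported in a fixed ball,
  `hasUniformRapidDecayOn_Icc_of_support`), the RAW residual size `‖r(t)‖₂ ≤ G₂`, and the numeral
  inequalities and four readouts of `CertificateDataSharp` verbatim. Every field is either a closed-form
  fact about explicit fields or an inequality between explicit reals.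
* **`RawCertificateData.certificateSharpAt`** — the RE-GAUGE: with `g := P r` (the tree's Leray projection
  of a Schwartz-on-slab force, `clayProjForce`, and `IsClassicalNSSolutionOn.to_clayProjForce`: the gradient
  part `∇Δ⁻¹∇·r` is absorbed into the pressure `ψ − Δ⁻¹∇·r`), the raw letter fills `CertificateDataSharp R`:
  `P r` is jointly continuous, bounded, weakly divergence free with `‖P r(t)‖₂ ≤ ‖r(t)‖₂ ≤ G₂`
  (`eLpNorm_two_clayProjForce_le`); `w, ∂ₜw ∈ L^∞_t H^k_x` from the uniform Schwartz bounds
  (`HasUniformRapidDecayOn.hasBoundedSobolevNormsOn_Icc`); the re-gauged pressure is in `L^∞_t H^k_x`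
  (`sobolev_forcePressure_forceData` for `Δ⁻¹∇·r`, the Schwartz bounds for `ψ`).
* `RawCertificateAt R` and **`episodeBaseGAt_of_mechanismDoorAt_of_rawCertificateAt`** —
  `MechanismDoorAt R → RawCertificateAt R → EpisodeBaseGAt R`, the shape of skeleton `Lines/straindoor.lean` v3.
* Tools: `isClassicalNSSolutionOn_of_residual` (any jointly smooth divergence-free `w` and jointly smooth `ψ`
  solve the system forced by their residual), `hasUniformRapidDecayOn_Icc_of_support` (jointly smooth and
  supported in a fixed ball on the slab ⟹ uniform Schwartz bounds).

References: T. Tao, Anal. PDE 6 (2013), (8) p. 3 and Thm. 5.4 (iv) [cite: Tao2011, (8) p. 3];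
P. G. Lemarié-Rieusset, CRC 2016, §6.1 [cite: LemarieRieusset2016, §6.1]; S. Palasek, arXiv:2605.13827 §4
[cite: Palasek2026ElementaryModel, §4]; M. Dashti, J. C. Robinson, SIAM J. Numer. Anal. 46 (2008), Thm. 5
[cite: DashtiRobinson2008, Thm. 5].
-/

noncomputable section

namespace Summit.NavierStokesRegularity.FluidComputer.PalasekTowerClayBridge.StrainDoor

open Set MeasureTheory Metric Function InnerProductSpace Filter Topology
open scoped ENNReal NNReal ContDiff RealInnerProductSpace FourierTransform Laplacian
open Literature.Analysis Literature.Analysis.FluidPDE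

/-! ## §1 Tools: the residual tautology and uniform Schwartz bounds from a fixed support ball -/

section Tools

variable {X : Type*} [NormedAddCommGroup X] [InnerProductSpace ℝ X] [FiniteDimensional ℝ X]
  {F : Type*} [NormedAddCommGroup F] [NormedSpace ℝ F]

/-- **Uniform Schwartz bounds from a fixed support ball.** A field jointly smooth on the slab
`[0, T] × X` (`T > 0`) whose slices vanish outside the ball `‖x‖ ≤ ρ` for every `t ∈ [0, T]` has the
uniform bounds `(1 + ‖x‖)^K ‖Dⁿ(uncurry w)(t, x)‖ ≤ C_{n,K}` on the slab (the derivatives within the slab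
are continuous on the compact `[0, T] × B̄(0, ρ)` and vanish outside it). [folklore] -/
theorem hasUniformRapidDecayOn_Icc_of_support {T ρ : ℝ} (hT : 0 < T) {w : ℝ → X → F}
    (hw : IsSmoothSpaceTimeOn (Icc 0 T) w) (hsupp : ∀ t ∈ Icc 0 T, ∀ x, ρ < ‖x‖ → w t x = 0) :
    HasUniformRapidDecayOn (Icc 0 T) w := by
  intro n K
  have hU : UniqueDiffOn ℝ (Icc 0 T ×ˢ (univ : Set X)) := (uniqueDiffOn_Icc hT).prod uniqueDiffOn_univ
  -- the derivative within the slab is continuous on the slab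
  have hcont : ContinuousOn (iteratedFDerivWithin ℝ n (uncurry w) (Icc 0 T ×ˢ univ)) (Icc 0 T ×ˢ univ) :=
    hw.continuousOn_iteratedFDerivWithin (by exact_mod_cast le_top) hU
  -- hence bounded on the compact `[0, T] × B̄(0, ρ)`
  have hcpt : IsCompact (Icc 0 T ×ˢ closedBall (0 : X) ρ) :=
    isCompact_Icc.prod (isCompact_closedBall 0 ρ)
  obtain ⟨M, hM⟩ := hcpt.exists_bound_of_continuousOn
    (hcont.mono (prod_mono subset_rfl (subset_univ _)))
  -- outside the ball the derivative vanishes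
  have hzero : ∀ t ∈ Icc 0 T, ∀ x : X, ρ < ‖x‖ →
      iteratedFDerivWithin ℝ n (uncurry w) (Icc 0 T ×ˢ univ) (t, x) = 0 := by
    intro t ht x hx
    have hopen : IsOpen {q : ℝ × X | ρ < ‖q.2‖} := isOpen_lt continuous_const (continuous_norm.comp continuous_snd)
    have hev : uncurry w =ᶠ[𝓝[Icc 0 T ×ˢ univ] (t, x)] (0 : ℝ × X → F) := by
      filter_upwards [inter_mem_nhdsWithin (Icc 0 T ×ˢ (univ : Set X)) (hopen.mem_nhds (by exact hx))]
        with q hq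
      exact hsupp q.1 hq.1.1 q.2 hq.2
    rw [hev.iteratedFDerivWithin_eq (by exact hsupp t ht x hx) n, iteratedFDerivWithin_zero]
    rfl
  refine ⟨(1 + |ρ|) ^ K * max M 0, fun t ht x => ?_⟩
  rcases le_or_gt ‖x‖ ρ with hx | hx
  · have h1 : (1 + ‖x‖) ^ K ≤ (1 + |ρ|) ^ K :=
      pow_le_pow_left₀ (by positivity) (by linarith [le_abs_self ρ]) K
    have h2 : ‖iteratedFDerivWithin ℝ n (uncurry w) (Icc 0 T ×ˢ univ) (t, x)‖ ≤ max M 0 :=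
      (hM (t, x) ⟨ht, mem_closedBall_zero_iff.2 hx⟩).trans (le_max_left _ _)
    exact mul_le_mul h1 h2 (norm_nonneg _) (by positivity)
  · rw [hzero t ht x hx, norm_zero, mul_zero]
    positivity

end Tools

/-- **The residual tautology**: a jointly smooth field `w` with divergence-free slices and a jointly smooth
scalar `ψ` on a time set `S` form a classical solution at viscosity `ν` of the Navier–Stokes system FORCED BY
THEIR RESIDUAL `r = ∂ₜw + (w·∇)w − νΔw + ∇ψ` (the momentum equation holds by definition of `r`). This is how a
certificate's explicit pseudo-run enters the kernel. [cite: DashtiRobinson2008, Thm. 5] -/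
theorem isClassicalNSSolutionOn_of_residual {S : Set ℝ} {ν : ℝ}
    {w : ℝ → EuclideanSpace ℝ (Fin 3) → EuclideanSpace ℝ (Fin 3)} {ψ : ℝ → EuclideanSpace ℝ (Fin 3) → ℝ}
    (hw : IsSmoothSpaceTimeOn S w) (hψ : IsSmoothSpaceTimeOn S ψ)
    (hdiv : ∀ t ∈ S, VectorCalculus.IsDivFree (w t)) :
    IsClassicalNSSolutionOn S ν
      (fun t x => FluidPDE.timeDerivWithin S w t x + convect (w t) (w t) x - ν • (Δ (w t)) x +
        gradient (ψ t) x) w ψ where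
  smooth_velocity := hw
  smooth_pressure := hψ
  momentum t _ x := by abel
  divFree := hdiv

/-! ## §2 The RAW strain certificate at the rates `R` -/

/-- **The data of ONE RAW STRAIN CERTIFICATE at the rates `R`** — the letter a validated computation checks:
an explicit datum `U`, an explicit pair `(w, ψ)` solving on `[0, wfirstAt R]` the system forced by its own RAW
residual `r` (`isClassicalNSSolutionOn_of_residual`), uniform Schwartz bounds for `w`, `ψ`, `r` on the slab
(`hasUniformRapidDecayOn_Icc_of_support` for fields supported in a fixed ball), the raw residual size
`‖r(t)‖₂ ≤ G₂`, the speed bound `B_w`, the compression-rate majorant `Γ`, the datum gaps `D`, `E₀`, the short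
window `h` and the tolerance `δ` with the NUMERAL inequalities of `CertificateDataSharp` (slice constant
`9.03`), and the four explicit readouts with margins `η + δ`. [cite: Palasek2026ElementaryModel, §4]
[cite: DashtiRobinson2008, Thm. 5] -/
structure RawCertificateData (R : TowerRates)
    (U : EuclideanSpace ℝ (Fin 3) → EuclideanSpace ℝ (Fin 3)) (ρ : ℝ)
    (w : ℝ → EuclideanSpace ℝ (Fin 3) → EuclideanSpace ℝ (Fin 3)) (ψ : ℝ → EuclideanSpace ℝ (Fin 3) → ℝ)
    (r : ℝ → EuclideanSpace ℝ (Fin 3) → EuclideanSpace ℝ (Fin 3))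
    (Γ : ℝ → ℝ) (Bw G₂ D E₀ h δ η : ℝ) : Prop where
  /-- the datum is smooth … -/
  datum_smooth : ContDiff ℝ ∞ U
  /-- … divergence free … -/
  datum_divFree : VectorCalculus.IsDivFree U
  /-- … supported in the readout ball `B̄(0, ρ)` … -/
  datum_support : tsupport U ⊆ closedBall 0 ρ
  /-- … of speed below the level-`0` scale `Y₀(R)` (the anchor) -/
  datum_lt : ∀ x, ‖U x‖ < R.Y 0
  /-- the readout radius is a genuine radius -/
  radius_nonneg : 0 ≤ ρ
  /-- THE REFERENCE PAIR `(w, ψ)` solves, at unit viscosity on `[0, wfirstAt R]`, the system forced by its RAW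
  residual `r` (a tautology once `r` is defined by the momentum equation) -/
  run : IsClassicalNSSolutionOn (Icc 0 (Host.wfirstAt R)) 1 r w ψ
  /-- uniform Schwartz bounds on the slab for the velocity … -/
  velocity_decay : HasUniformRapidDecayOn (Icc 0 (Host.wfirstAt R)) w
  /-- … the pressure … -/
  pressure_decay : HasUniformRapidDecayOn (Icc 0 (Host.wfirstAt R)) ψ
  /-- … and the residual -/
  residual_decay : HasUniformRapidDecayOn (Icc 0 (Host.wfirstAt R)) r
  /-- THE RAW RESIDUAL SIZE in `L²`, `G₂ ≥ 0` -/
  G₂_nonneg : 0 ≤ G₂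
  residual_two : ∀ τ ∈ Icc 0 (Host.wfirstAt R), eLpNorm (r τ) 2 volume ≤ ENNReal.ofReal G₂
  /-- the speed bound of the reference, `B_w > 0` -/
  Bw_pos : 0 < Bw
  speed_bdd : ∀ t ∈ Icc 0 (Host.wfirstAt R), ∀ y, ‖w t y‖ ≤ Bw
  /-- THE STRAIN MAJORANT: `Γ ≥ 0` continuous dominates the maximal compression rate of the reference -/
  Γ_cont : ContinuousOn Γ (Icc 0 (Host.wfirstAt R))
  Γ_nonneg : ∀ t ∈ Icc 0 (Host.wfirstAt R), 0 ≤ Γ t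
  strain : ∀ t ∈ Icc 0 (Host.wfirstAt R), ∀ x ξ, -⟪ξ, fderiv ℝ (w t) x ξ⟫ ≤ Γ t * ‖ξ‖ ^ 2
  /-- the datum defect in sup norm … -/
  datum_sup : ∀ y, ‖w 0 y - U y‖ ≤ D
  /-- … and in `L²` (`E₀ ≥ 0`) -/
  E₀_nonneg : 0 ≤ E₀
  datum_two : ∫ x, ‖U x - w 0 x‖ ^ 2 ≤ E₀ ^ 2
  /-- the terminal smoothing window `h > 0` is SHORT for the sup-norm theory (NUMERAL threshold) -/
  h_pos : 0 < h
  h_short : (24 * (9.03 : ℝ) * (Bw + 1 + Bw)) ^ 2 * h ≤ 1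
  /-- the tolerance: `δ ≤ 1/2`, the initial-layer inequality (NUMERAL) and the window inequality -/
  δ_le : δ ≤ 1 / 2
  δ_layer : 2 * (D + 4 * h ^ (1 / 4 : ℝ) * G₂) * Real.exp (36 * (9.03 : ℝ) ^ 2 * (Bw + 1 + Bw) ^ 2 * h) ≤ δ
  δ_window : 2 * ((E₀ + G₂ * Host.wfirstAt R) * Real.exp (∫ s in (0 : ℝ)..Host.wfirstAt R, Γ s) +
    4 * G₂ * h) * h ^ (-(3 / 4 : ℝ)) ≤ δ
  /-- the margin of the readouts -/
  η_pos : 0 < η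
  /-- READOUT 1 — the cap with margin `η + δ` on the whole window -/
  cap : ∀ t ∈ Icc 0 (Host.wfirstAt R), ∀ x, ‖w t x‖ ≤ 5 / 3 * R.Y 1 - η - δ
  /-- READOUT 2 — the speed floor with margin `η + δ` inside the readout ball -/
  speed : ∃ x, ‖x‖ ≤ ρ ∧ R.Y 1 + η + δ ≤ ‖w (Host.wfirstAt R) x‖
  /-- READOUT 3 — the strain floor by a finite difference inside the readout ball -/
  strainFD : ∃ x₀ x₁, ‖x₀‖ ≤ ρ ∧ ‖x₁‖ ≤ ρ ∧
    (R.A 1 + η) * ‖x₁ - x₀‖ + 2 * δ < ‖w (Host.wfirstAt R) x₁ - w (Host.wfirstAt R) x₀‖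
  /-- READOUT 4 — the core loop with margin `η + δ · 8π/N₁` -/
  core : ∃ (x : EuclideanSpace ℝ (Fin 3)) (γ : ℝ → EuclideanSpace ℝ (Fin 3)),
    ‖x‖ ≤ ρ ∧ ContDiff ℝ 1 γ ∧ γ 0 = γ 1 ∧
    (∀ s ∈ Icc (0 : ℝ) 1, γ s ∈ closedBall x (1 / R.N 1)) ∧
    (∀ s ∈ Icc (0 : ℝ) 1, ‖deriv γ s‖ ≤ 8 * Real.pi / R.N 1) ∧
    R.N 1 ^ (R.β - 2) + η + δ * (8 * Real.pi / R.N 1) ≤ circulation (w (Host.wfirstAt R)) γ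

/-- **ONE RAW STRAIN CERTIFICATE at the rates `R`** (open `Prop`, the mechanism, in the letter a computation
checks). [cite: Palasek2026ElementaryModel, §4] -/
def RawCertificateAt (R : TowerRates) : Prop :=
  ∃ (U : EuclideanSpace ℝ (Fin 3) → EuclideanSpace ℝ (Fin 3)) (ρ : ℝ)
    (w : ℝ → EuclideanSpace ℝ (Fin 3) → EuclideanSpace ℝ (Fin 3)) (ψ : ℝ → EuclideanSpace ℝ (Fin 3) → ℝ)
    (r : ℝ → EuclideanSpace ℝ (Fin 3) → EuclideanSpace ℝ (Fin 3))
    (Γ : ℝ → ℝ) (Bw G₂ D E₀ h δ η : ℝ), RawCertificateData R U ρ w ψ r Γ Bw G₂ D E₀ h δ η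

/-! ## §3 The re-gauge: RAW letter ⟹ numeral letter ⟹ `EpisodeBaseGAt R` -/

variable {R : TowerRates}

/-- Sobolev bounds of a re-gauged pressure `p₁ + (-1) • p₂`: `∫ ‖Dⁿ(p₁ − p₂)‖² ≤ 2∫‖Dⁿp₁‖² + 2∫‖Dⁿp₂‖²` for
smooth `p₁`, `p₂`. [folklore] -/
private theorem lintegral_sq_norm_iteratedFDeriv_add_neg_smul_le
    {p₁ p₂ : EuclideanSpace ℝ (Fin 3) → ℝ} (h₁ : ContDiff ℝ ∞ p₁) (h₂ : ContDiff ℝ ∞ p₂) (n : ℕ) :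
    ∫⁻ x, ‖iteratedFDeriv ℝ n (fun y => p₁ y + (-1 : ℝ) • p₂ y) x‖ₑ ^ 2 ≤
      (2 * ∫⁻ x, ‖iteratedFDeriv ℝ n p₁ x‖ₑ ^ 2) + 2 * ∫⁻ x, ‖iteratedFDeriv ℝ n p₂ x‖ₑ ^ 2 := by
  have h₁n : ContDiff ℝ n p₁ := contDiff_infty.1 h₁ n
  have h₂n : ContDiff ℝ n p₂ := contDiff_infty.1 h₂ n
  have h₂n' : ContDiff ℝ n (fun y => (-1 : ℝ) • p₂ y) := h₂n.const_smul (-1 : ℝ)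
  have hmeas : AEMeasurable (fun x => ‖iteratedFDeriv ℝ n p₁ x‖ₑ ^ 2) volume :=
    ((h₁n.continuous_iteratedFDeriv (m := n) le_rfl).enorm.measurable.pow_const 2).aemeasurable
  have heq : (fun y => p₁ y + (-1 : ℝ) • p₂ y) = p₁ + fun y => (-1 : ℝ) • p₂ y := rfl
  rw [heq]
  calc ∫⁻ x, ‖iteratedFDeriv ℝ n (p₁ + fun y => (-1 : ℝ) • p₂ y) x‖ₑ ^ 2
      ≤ ∫⁻ x, (2 * ‖iteratedFDeriv ℝ n p₁ x‖ₑ ^ 2 + 2 * ‖iteratedFDeriv ℝ n p₂ x‖ₑ ^ 2) := by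
        refine lintegral_mono fun x => ?_
        rw [iteratedFDeriv_add_apply h₁n.contDiffAt h₂n'.contDiffAt,
          iteratedFDeriv_const_smul_apply' h₂n.contDiffAt]
        set A := iteratedFDeriv ℝ n p₁ x
        set B := iteratedFDeriv ℝ n p₂ x
        have hB : ‖(-1 : ℝ) • B‖ = ‖B‖ := by rw [norm_smul, norm_neg, norm_one, one_mul]
        have hreal : ‖A + (-1 : ℝ) • B‖ ^ 2 ≤ 2 * ‖A‖ ^ 2 + 2 * ‖B‖ ^ 2 := by
          have h := norm_add_le A ((-1 : ℝ) • B)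
          rw [hB] at h
          nlinarith [h, sq_nonneg (‖A‖ - ‖B‖), norm_nonneg (A + (-1 : ℝ) • B), norm_nonneg A,
            norm_nonneg B]
        calc ‖A + (-1 : ℝ) • B‖ₑ ^ 2 = ENNReal.ofReal (‖A + (-1 : ℝ) • B‖ ^ 2) := by
              rw [← ofReal_norm, ENNReal.ofReal_pow (norm_nonneg _)]
          _ ≤ ENNReal.ofReal (2 * ‖A‖ ^ 2 + 2 * ‖B‖ ^ 2) := ENNReal.ofReal_le_ofReal hreal
          _ = 2 * ‖A‖ₑ ^ 2 + 2 * ‖B‖ₑ ^ 2 := by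
              rw [ENNReal.ofReal_add (by positivity) (by positivity), ENNReal.ofReal_mul zero_le_two,
                ENNReal.ofReal_mul zero_le_two, ENNReal.ofReal_pow (norm_nonneg _),
                ENNReal.ofReal_pow (norm_nonneg _), ofReal_norm, ofReal_norm, ENNReal.ofReal_ofNat]
    _ = (2 * ∫⁻ x, ‖iteratedFDeriv ℝ n p₁ x‖ₑ ^ 2) + 2 * ∫⁻ x, ‖iteratedFDeriv ℝ n p₂ x‖ₑ ^ 2 := by
        rw [lintegral_add_left' (hmeas.const_mul _), lintegral_const_mul' _ _ (by simp),
          lintegral_const_mul' _ _ (by simp)]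

/-- **THE RE-GAUGE: a raw strain certificate at `R` fills the numeral letter.** With `g := P r` (Leray
projection of the Schwartz-on-slab residual, `clayProjForce`) and the pressure `ψ − Δ⁻¹∇·r`
(`IsClassicalNSSolutionOn.to_clayProjForce`), the data of `RawCertificateData R` give `CertificateSharpAt R`:
`P r` is jointly continuous (`continuous_uncurry_clayProjForce`), bounded (`exists_norm_clayProjForce_le`), weakly
divergence free (`isWeaklyDivFree_clayProjForce`), `‖P r(t)‖₂ ≤ ‖r(t)‖₂ ≤ G₂` (`eLpNorm_two_clayProjForce_le`);
`w, ∂ₜw ∈ L^∞_t H^k_x` (`HasUniformRapidDecayOn.hasBoundedSobolevNormsOn_Icc`); the re-gauged pressure is in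
`L^∞_t H^k_x` (`sobolev_forcePressure_forceData` and the Schwartz bounds of `ψ`). [cite: Tao2011, (8) p. 3]
[cite: LemarieRieusset2016, §6.1] -/
theorem RawCertificateData.certificateSharpAt
    {U : EuclideanSpace ℝ (Fin 3) → EuclideanSpace ℝ (Fin 3)} {ρ : ℝ}
    {w : ℝ → EuclideanSpace ℝ (Fin 3) → EuclideanSpace ℝ (Fin 3)} {ψ : ℝ → EuclideanSpace ℝ (Fin 3) → ℝ}
    {r : ℝ → EuclideanSpace ℝ (Fin 3) → EuclideanSpace ℝ (Fin 3)}
    {Γ : ℝ → ℝ} {Bw G₂ D E₀ h δ η : ℝ} (c : RawCertificateData R U ρ w ψ r Γ Bw G₂ D E₀ h δ η) :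
    CertificateSharpAt R := by
  set W : ℝ := Host.wfirstAt R with hW_def
  have hW : 0 < W := Host.wfirstAt_pos R
  have hUW : UniqueDiffOn ℝ (Icc 0 W) := uniqueDiffOn_Icc hW
  -- the residual is a Schwartz-on-slab force
  have hrs : IsSmoothSpaceTimeOn (Icc 0 W) r := c.run.isSmoothSpaceTimeOn_force hUW
  have hrd : HasUniformRapidDecayOn (Icc 0 W) r := c.residual_decay
  -- the re-gauged run, forced by the Leray projection of the residual
  have hrun := c.run.to_clayProjForce hW hrs hrd
  obtain ⟨Gb, -, hGb⟩ := exists_norm_clayProjForce_le hW hrs hrd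
  -- Tao's class for the reference
  have hsob := c.velocity_decay.hasBoundedSobolevNormsOn_Icc c.run.smooth_velocity hW
  have hψS : ∀ n : ℕ, ∃ C : ℝ≥0, ∀ t ∈ Icc 0 W, ∫⁻ x, ‖iteratedFDeriv ℝ n (ψ t) x‖ₑ ^ 2 ≤ C :=
    fun n => c.pressure_decay.exists_lintegral_iteratedFDeriv_slice_sq_le_Icc (μ := volume)
      c.run.smooth_pressure hW n
  refine ⟨U, ρ, w, clayProjForce hW hrs hrd,
    fun t x => ψ t x + (-1 : ℝ) • (𝓕 (FourierNS.forcePresSymbol (FourierNS.forceData hW hrs hrd t)) x).re,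
    Γ, Bw, Gb, G₂, D, E₀, h, δ, η, ?_⟩
  exact
    { datum_smooth := c.datum_smooth
      datum_divFree := c.datum_divFree
      datum_support := c.datum_support
      datum_lt := c.datum_lt
      radius_nonneg := c.radius_nonneg
      run := hrun
      defect_cont := continuous_uncurry_clayProjForce hW hrs hrd
      defect_bdd := fun τ _ y => hGb τ y
      defect_divFree := fun τ _ => isWeaklyDivFree_clayProjForce hW hrs hrd τ
      G₂_nonneg := c.G₂_nonneg
      defect_two := fun τ hτ => by
        refine (eLpNorm_two_clayProjForce_le hW hrs hrd τ).trans ?_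
        rw [FourierNS.clamp_of_mem hτ]
        exact c.residual_two τ hτ
      energy := by
        obtain ⟨C, hC⟩ := hsob.1 0
        refine ⟨C, ENNReal.coe_lt_top, fun t ht => ?_⟩
        refine (le_of_eq (lintegral_congr fun x => ?_)).trans (hC t ht)
        rw [← ofReal_norm, ← ofReal_norm, norm_iteratedFDeriv_zero]
      sobolev := hsob.1
      sobolev_t := hsob.2
      pressure := fun n => by
        obtain ⟨C₁, hC₁⟩ := hψS n
        obtain ⟨C₂, hC₂⟩ := FourierNS.sobolev_forcePressure_forceData hW hrs hrd n
        refine ⟨2 * C₁ + 2 * C₂, fun t ht => ?_⟩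
        have h1 : ContDiff ℝ ∞ (ψ t) := c.run.smooth_pressure.contDiff_slice ht
        have h2 : ContDiff ℝ ∞ fun y =>
            (𝓕 (FourierNS.forcePresSymbol (FourierNS.forceData hW hrs hrd t)) y).re :=
          (FourierNS.isSmoothSpaceTimeOn_forcePressure_forceData hW hrs hrd).contDiff_slice ht
        calc ∫⁻ x, ‖iteratedFDeriv ℝ n (fun y => ψ t y +
              (-1 : ℝ) • (𝓕 (FourierNS.forcePresSymbol (FourierNS.forceData hW hrs hrd t)) y).re) x‖ₑ ^ 2
            ≤ (2 * ∫⁻ x, ‖iteratedFDeriv ℝ n (ψ t) x‖ₑ ^ 2) +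
              2 * ∫⁻ x, ‖iteratedFDeriv ℝ n (fun y =>
                (𝓕 (FourierNS.forcePresSymbol (FourierNS.forceData hW hrs hrd t)) y).re) x‖ₑ ^ 2 :=
              lintegral_sq_norm_iteratedFDeriv_add_neg_smul_le h1 h2 n
          _ ≤ 2 * (C₁ : ℝ≥0∞) + 2 * (C₂ : ℝ≥0∞) := by
              gcongr
              · exact hC₁ t ht
              · exact hC₂ t ht
          _ = ((2 * C₁ + 2 * C₂ : ℝ≥0) : ℝ≥0∞) := by push_cast; ring
      Bw_pos := c.Bw_pos
      speed_bdd := c.speed_bdd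
      Γ_cont := c.Γ_cont
      Γ_nonneg := c.Γ_nonneg
      strain := c.strain
      datum_sup := c.datum_sup
      E₀_nonneg := c.E₀_nonneg
      datum_two := c.datum_two
      h_pos := c.h_pos
      h_short := c.h_short
      δ_le := c.δ_le
      δ_layer := c.δ_layer
      δ_window := c.δ_window
      η_pos := c.η_pos
      slice_cont := (c.run.contDiff_velocity ⟨hW.le, le_rfl⟩).continuous
      cap := c.cap
      speed := c.speed
      strainFD := c.strainFD
      core := c.core }

/-- A raw strain certificate at `R` is a numeral strain certificate at `R`. [cite: Tao2011, (8) p. 3] -/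
theorem certificateSharpAt_of_rawCertificateAt (h : RawCertificateAt R) : CertificateSharpAt R := by
  obtain ⟨U, ρ, w, ψ, r, Γ, Bw, G₂, D, E₀, h, δ, η, c⟩ := h
  exact c.certificateSharpAt

/-- **THE RAW STRAIN DOOR AT `R`**: `MechanismDoorAt R → RawCertificateAt R → EpisodeBaseGAt R` — the shape of the
skeleton `Cruxes/EpisodeBaseT/Lines/straindoor.lean` v3 (`R = TowerRates.tuned`, `EpisodeBaseGAt tuned = EpisodeBaseT`
by `Iff.rfl`). [cite: Palasek2026ElementaryModel, §4] [cite: DashtiRobinson2008, Thm. 5] -/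
theorem episodeBaseGAt_of_mechanismDoorAt_of_rawCertificateAt (hdoor : MechanismDoorAt R)
    (hcert : RawCertificateAt R) : EpisodeBaseGAt R :=
  episodeBaseGAt_of_mechanismDoorAt_of_certificateSharpAt hdoor (certificateSharpAt_of_rawCertificateAt hcert)

end Summit.NavierStokesRegularity.FluidComputer.PalasekTowerClayBridge.StrainDoor

end
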